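import Summits.BirchSwinnertonDyer.BirchSwinnertonDyer.Theses.SignedBaseChange
import Summits.BirchSwinnertonDyer.Rank1Residual.X11b.RouteR1IntReceptacle
import Literature.NumberTheory.EllipticCurves.CyclotomicIwasawaMainTheoremIrreducibleProofs
import Literature.NumberTheory.EllipticCurves.YanZhu2026.GreenbergDivisibilityAwayFromCycProofs
import HarnessLib

/-!
# K1′ `TwistPairGreenbergProductDivisibilitySplit` (stmt-BirchSwinnertonDyer-20502): the ZERO-FRAME
# OBSTRUCTION — what every in-tree proof of the `∀`-over-frames product clause must refute
# (route SignedBaseChange; helper file, lead sbc-p1 g3)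

The `∀`-over-frames clause of K1′ (and of its one open stub `stub_productDivisibilityBCS`, and of every
binder written in the same currency: K1 20249, BSTW `thm924_…_OPEN`) quantifies over ALL triples
`(LK, G, G′)` with `IsKatzMeasure₂ … LK`, `IsGreenbergLFunctionAnyRoot₂ … f … LK G`,
`IsGreenbergLFunctionAnyRoot₂ … f′ … LK G′`. Both frames are pure `∀`-INTERPOLATION predicates
(a value is prescribed at every character of the typed range; nothing is asserted to exist). Hence:

* `isGreenbergLFunctionAnyRoot₂_zero_zero`: over the zero Katz series `LK = 0` the zero series `G = 0`
  IS a Greenberg frame, for every `f` — the Greenberg value is `h_K · y · (…)` with `y` THE value of `LK`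
  at `(0, r(γ₂)² − 1)`, and `y = 0` when `LK = 0`.
* `productClause_false_of_isKatzMeasure₂_zero`: consequently, if the zero series were a Katz frame for
  some period data `(Ω ≠ 0, δ² = ±d_K, Ωp)`, the product clause FAILS: at `(0, 0, 0)` it demands
  `(C s) · ch(X_Gr(E/K̃_∞)) · ch(X_Gr(E′/K̃_∞)) ⊆ (0)` with `s ≠ 0`, and the left side is a product of
  three non-zero ideals of the domain `𝒪_{ℂ_p}⟦T₁⟧⟦T₂⟧` (`Module.charIdeal_ne_bot`; `toUnr₂ J` is
  injective for the structure map `J = X11b.R1.toCpInt`, `structureMap_injective`).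
* `not_isKatzMeasure₂_zero_of_split` (headline): **K1′ as typed implies**, for every X7 pair `(E, p ≥ 5)`
  with surjective `ρ̄` (granted modularity), the existence of an imaginary quadratic `K` with `p = v v̄`
  split (`v` induced by `ι`), its cyclotomic/anticyclotomic `ℤ_p²`-tower with generator pair, such that
  **the zero series is NOT a Katz–de Shalit two-variable branch for any period data** — i.e. the typed
  Katz range over that tower contains a character (Hecke character WITH `p`-adic avatar factoring through
  the pair, an object of class field theory) whose prescribed value `ι⁻¹(interpolationValue …)·Ωp^{m+j}`
  is non-zero. The tree has no construction of such a character (no reciprocity map), so this consequence —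
  true in print (de Shalit 1987 II.4.14: the measure is non-zero) — is not provable in-tree today; a
  fortiori neither is K1′, except by modus ponens from a binder in the same `∀`-frame currency. The same
  instantiation shows that no bridge from an `∃`-frame statement (e.g. the conjecture leaf BCS 4.1.2) can
  reach K1′ without that character either.
* For the registered stub `stub_productDivisibilityBCS` (the same clause for ALL admissible data) the
  core lemma `productClause_false_of_isKatzMeasure₂_zero` is already the statement: the stub's conclusion
  at a datum is the negated clause, so the stub implies `¬ IsKatzMeasure₂ … 0` at every admissible datum.

Pure logic and commutative algebra over the tree's definitions; no new definitions, no named fact used.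
-/

-- D-0017: single-problem summit, the namespace repeats the problem name by design.
set_option linter.dupNamespace false
set_option autoImplicit false

noncomputable section

open scoped Classical

namespace Summit.BirchSwinnertonDyer.BirchSwinnertonDyer.Theorems.SignedBaseChangeK1ZeroFrame

open Summit.BirchSwinnertonDyer.BirchSwinnertonDyer.Theses.SignedBaseChange
open NumberField IsDedekindDomain Field CongruenceSubgroup
open Literature.NumberTheory.GaloisRepresentations Literature.NumberTheory.EllipticCurves
open Literature.NumberTheory.EllipticCurves.ModularForms Literature.NumberTheory.EllipticCurves.Rank1Residual
open Literature.NumberTheory.EllipticCurves.IwasawaAlgebra₂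
open Summit.BirchSwinnertonDyer.Rank1Residual.X11b

variable {p : ℕ} [Fact p.Prime]

/-! ## §1. The zero series in the two frames -/

/-- The zero series has value `0` at every point, and only that value. [folklore] -/
theorem hasValueAt₂_zero_iff (x y w : ℂ_[p]) :
    IntSeries.HasValueAt₂ (0 : PowerSeries (PowerSeries (PadicComplexInt p))) x y w ↔ w = 0 := by
  have h0 : IntSeries.HasValueAt₂ (0 : PowerSeries (PowerSeries (PadicComplexInt p))) x y 0 := by
    unfold IntSeries.HasValueAt₂
    simp
  exact ⟨fun h ↦ h.unique h0, fun h ↦ h ▸ h0⟩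

/-- **Over the zero Katz series, the zero series is a Greenberg frame** (for every newform `f`, level of
`θ`, class number): the prescribed value `h_K · y · ι⁻¹(…)` vanishes because `y`, the value of `LK = 0`
at `(0, r(γ₂)² − 1)`, is `0`. [folklore] -/
theorem isGreenbergLFunctionAnyRoot₂_zero_zero {K : Type} [Field K] [NumberField K]
    (ι : PadicAlgCl p ≃+* ℂ) (v vbar : HeightOneSpectrum (𝓞 K)) (κ₁ κ₂ : ZpExtension K p)
    (g₁ g₂ : absoluteGaloisGroup K) {N : ℕ} (f : CuspForm (Gamma0 N) 2) (D : ℕ) [NeZero D]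
    (hK : ℕ) :
    IsGreenbergLFunctionAnyRoot₂ ι v vbar κ₁ κ₂ g₁ g₂ f D hK 0 0 := by
  intro ξ r m n α _ _ _ _ _ θ _ L _ _ y hy
  obtain rfl := (hasValueAt₂_zero_iff _ _ _).mp hy
  rw [mul_zero, zero_mul]
  exact (hasValueAt₂_zero_iff _ _ _).mpr rfl

/-! ## §2. The product clause fails at the zero triple -/

/-- The structure map `J = X11b.R1.toCpInt : ℤ_p → 𝓞_{ℂ_p}` is compatible with `ℤ_p ⊂ ℚ_p ⊂ ℂ_p`.
[folklore] -/
theorem coe_toCpInt (x : ℤ_[p]) :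
    ((R1.toCpInt p x : PadicComplexInt p) : ℂ_[p]) = ((x : ℚ_[p]) : ℂ_[p]) := by
  rw [R1.coe_toCpInt, PadicComplex.coe_eq, ← IsScalarTower.algebraMap_apply]

/-- `toUnr₂ J` is injective for an injective `J` (coefficientwise). [folklore] -/
theorem toUnr₂_injective {J : ℤ_[p] →+* PadicComplexInt p} (hJ : Function.Injective J) :
    Function.Injective (toUnr₂ p J) :=
  PowerSeries.map_injective _ (PowerSeries.map_injective _ hJ)

/-- The extension of a characteristic ideal of `Λ₂ = ℤ_p⟦T₁⟧⟦T₂⟧` along an injective `toUnr₂ J` is a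
non-zero ideal of `𝒪_{ℂ_p}⟦T₁⟧⟦T₂⟧` (`Module.charIdeal` is never `⊥` over a domain). [folklore] -/
theorem map_charIdeal_ne_bot {K : Type} [Field K] [NumberField K] (W : WeierstrassCurve K)
    (κ₁ κ₂ : ZpExtension K p) (vbar : HeightOneSpectrum (𝓞 K)) (γ₁ γ₂ : absoluteGaloisGroup K)
    [Fact (ZpExtension.IsTopGeneratorPair κ₁ κ₂ γ₁ γ₂)] {J : ℤ_[p] →+* PadicComplexInt p}
    (hJ : Function.Injective J) :
    (WeierstrassCurve.XGr₂.charIdeal W p κ₁ κ₂ vbar γ₁ γ₂).map (toUnr₂ p J) ≠ ⊥ := by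
  intro h
  rw [Ideal.map_eq_bot_iff_le_ker, (RingHom.injective_iff_ker_eq_bot _).mp (toUnr₂_injective hJ),
    le_bot_iff] at h
  exact Module.charIdeal_ne_bot (IwasawaAlgebra₂ p) _ h

/-- **The product clause fails at the zero triple.** If `0` is a Katz–de Shalit branch for the period data
`(Ω, δ, Ωp)` with `Ω ≠ 0`, `δ² = ±d_K`, then the `∀`-over-frames PRODUCT divisibility of K1/K1′ (for the
pair `(W, f)`, `(W′, f′)` over the tower `(κ₁, κ₂; γ₁, γ₂)`, Selmer side at `v̄`) is FALSE: instantiated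
at `(LK, G, G′) = (0, 0, 0)` and `J = R1.toCpInt` it asks `(C s)·ch·ch′ ⊆ (0)` with `s ≠ 0`. [folklore] -/
theorem productClause_false_of_isKatzMeasure₂_zero {K : Type} [Field K] [NumberField K]
    (ι : PadicAlgCl p ≃+* ℂ) (v vbar : HeightOneSpectrum (𝓞 K)) (κ₁ κ₂ : ZpExtension K p)
    (γ₁ γ₂ : absoluteGaloisGroup K) [Fact (ZpExtension.IsTopGeneratorPair κ₁ κ₂ γ₁ γ₂)]
    [NeZero (NumberField.discr K).natAbs] (W W' : WeierstrassCurve ℚ) {N N' : ℕ}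
    (f : CuspForm (Gamma0 N) 2) (f' : CuspForm (Gamma0 N') 2)
    {Ω δ : ℂ} {Ωp : (unrIntegers p)ˣ} (hΩ : Ω ≠ 0)
    (hδ : δ ^ 2 = (NumberField.discr K : ℂ) ∨ δ ^ 2 = -(NumberField.discr K : ℂ))
    (h0 : IsKatzMeasure₂ ι v vbar ∅ κ₁ κ₂ γ₁⁻¹ γ₂⁻¹ 1 Ω δ ((Ωp : unrIntegers p) : ℂ_[p]) 0) :
    ¬ (∀ (Ω δ : ℂ) (Ωp : (unrIntegers p)ˣ) (LK G G' : PowerSeries (PowerSeries (PadicComplexInt p))),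
        Ω ≠ 0 → (δ ^ 2 = (NumberField.discr K : ℂ) ∨ δ ^ 2 = -(NumberField.discr K : ℂ)) →
        IsKatzMeasure₂ ι v vbar ∅ κ₁ κ₂ γ₁⁻¹ γ₂⁻¹ 1 Ω δ ((Ωp : unrIntegers p) : ℂ_[p]) LK →
        IsGreenbergLFunctionAnyRoot₂ ι v vbar κ₁ κ₂ γ₁⁻¹ γ₂⁻¹ f (NumberField.discr K).natAbs
          (NumberField.classNumber K) LK G →
        IsGreenbergLFunctionAnyRoot₂ ι v vbar κ₁ κ₂ γ₁⁻¹ γ₂⁻¹ f' (NumberField.discr K).natAbs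
          (NumberField.classNumber K) LK G' →
        ∀ J : ℤ_[p] →+* PadicComplexInt p,
          (∀ x : ℤ_[p], ((J x : PadicComplexInt p) : ℂ_[p]) = ((x : ℚ_[p]) : ℂ_[p])) →
        ∃ s : PowerSeries (PadicComplexInt p), s ≠ 0 ∧
          Ideal.span {PowerSeries.map (PowerSeries.C (R := PadicComplexInt p)) s} *
              ((WeierstrassCurve.XGr₂.charIdeal (W.baseChange K) p κ₁ κ₂ vbar γ₁ γ₂).map (toUnr₂ p J) *
                (WeierstrassCurve.XGr₂.charIdeal (W'.baseChange K) p κ₁ κ₂ vbar γ₁ γ₂).map (toUnr₂ p J)) ≤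
            Ideal.span {G * G'}) := by
  intro hall
  obtain ⟨s, hs, hle⟩ := hall Ω δ Ωp 0 0 0 hΩ hδ h0
    (isGreenbergLFunctionAnyRoot₂_zero_zero ι v vbar κ₁ κ₂ γ₁⁻¹ γ₂⁻¹ f _ _)
    (isGreenbergLFunctionAnyRoot₂_zero_zero ι v vbar κ₁ κ₂ γ₁⁻¹ γ₂⁻¹ f' _ _)
    (R1.toCpInt p) coe_toCpInt
  have hJ : Function.Injective (R1.toCpInt p) := structureMap_injective coe_toCpInt
  rw [mul_zero, Ideal.span_singleton_zero, le_bot_iff, Ideal.mul_eq_bot, Ideal.mul_eq_bot,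
    Ideal.span_singleton_eq_bot] at hle
  rcases hle with hC | hA | hB
  · exact hs (PowerSeries.map_injective _ PowerSeries.C_injective (by simpa using hC))
  · exact map_charIdeal_ne_bot (W.baseChange K) κ₁ κ₂ vbar γ₁ γ₂ hJ hA
  · exact map_charIdeal_ne_bot (W'.baseChange K) κ₁ κ₂ vbar γ₁ γ₂ hJ hB

/-! ## §3. What K1′ (the crux) and its open stub therefore assert about the Katz range -/

/-- **K1′ forces a non-zero Katz value (headline).** `TwistPairGreenbergProductDivisibilitySplit` implies,
granted modularity: for every X7 pair `(W, p ≥ 5)` with surjective `ρ̄` there are an imaginary quadratic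
`K` with `p` split as `v ≠ v̄` (`v` induced by `ι`), its cyclotomic / anticyclotomic `ℤ_p`-extensions with
an adapted generator pair `(γ₁, γ₂)`, such that for ALL period data `(Ω ≠ 0, δ² = ±d_K, Ωp ∈ R₀ˣ)` the
zero series is NOT the two-variable Katz–de Shalit branch `IsKatzMeasure₂ ι v v̄ ∅ κ₁ κ₂ γ₁⁻¹ γ₂⁻¹ 1 Ω δ Ωp`
— i.e. some character of the typed Katz range over that tower has a non-zero prescribed value. (What any
proof of K1′ must exhibit; not constructible in the tree, which has no reciprocity map.) [folklore] -/
theorem not_isKatzMeasure₂_zero_of_split (h : TwistPairGreenbergProductDivisibilitySplit)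
    (hmodP : nonempty_modularParametrizationData) (W : WeierstrassCurve ℚ) [W.IsElliptic]
    [W.IsGloballyMinimal] (p : ℕ) [Fact p.Prime] (hp5 : 5 ≤ p) (hX : ClassX7 W p) (hs : Surj W p) :
    ∃ (K : Type) (_ : Field K) (_ : NumberField K) (ι : PadicAlgCl p ≃+* ℂ)
      (v vbar : HeightOneSpectrum (𝓞 K)) (κ₁ κ₂ : ZpExtension K p) (γ₁ γ₂ : absoluteGaloisGroup K)
      (_ : Fact (ZpExtension.IsTopGeneratorPair κ₁ κ₂ γ₁ γ₂)),
      IsImaginaryQuadratic K ∧ ((Ideal.span {(p : ℤ)}).primesOver (𝓞 K)).ncard = 2 ∧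
      ((p : ℕ) : 𝓞 K) ∈ v.asIdeal ∧ ((p : ℕ) : 𝓞 K) ∈ vbar.asIdeal ∧ vbar ≠ v ∧
      (∀ (w : InfinitePlace K) (k : 𝓞 K), k ∈ v.asIdeal ↔ ‖ι.symm (w.embedding (k : K))‖ < 1) ∧
      κ₁.IsCyclotomic ∧ κ₂.IsAnticyclotomic ∧
      ∀ (Ω δ : ℂ) (Ωp : (unrIntegers p)ˣ), Ω ≠ 0 →
        (δ ^ 2 = (NumberField.discr K : ℂ) ∨ δ ^ 2 = -(NumberField.discr K : ℂ)) →
        ¬ IsKatzMeasure₂ ι v vbar ∅ κ₁ κ₂ γ₁⁻¹ γ₂⁻¹ 1 Ω δ ((Ωp : unrIntegers p) : ℂ_[p]) 0 := by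
  obtain ⟨K, iF, iNF, ι, v, vbar, κ₁, κ₂, γ₁, γ₂, iPair, iD, N, iN, f, d, W', iE', iM', C, N', iN', f',
    -, -, -, -, -, -, -, -, h8, h9, h10, h11, h12, h13, -, -, -, -, -, h16, h17, hall⟩ :=
    h hmodP W p hp5 hX hs
  exact ⟨K, iF, iNF, ι, v, vbar, κ₁, κ₂, γ₁, γ₂, iPair, h8, h9, h10, h11, h12, h13, h16, h17,
    fun Ω δ Ωp hΩ hδ h0 ↦
      productClause_false_of_isKatzMeasure₂_zero ι v vbar κ₁ κ₂ γ₁ γ₂ W W' f f' hΩ hδ h0 hall⟩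

end Summit.BirchSwinnertonDyer.BirchSwinnertonDyer.Theorems.SignedBaseChangeK1ZeroFrame

end
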